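import Summits.QuantumFields.QCD.Theorems.QuarksAsStableActionCriticalLineDiamagnetismCellSecondOrderAux2

/-!
# B6 cell sub-stub `cellSecondOrder`, Aux 3: planar identification of the torus walk sums below the girth
(crux `stmt-QuantumFields-9734`, decl `Summit.QuantumFields.QCD.Theses.QuarksAsStableAction.CriticalLineDiamagnetism`,
line `Sketch`, Route B step B6; sub-problem context `Summits/QuantumFields/QCD/Statement.lean`)

The antiperiodic seam signs of `freqOpR` form a flat `ℤ₂` connection on the torus `(ℤ/L)²`; pulled back to the planar cover
it is pure gauge, `σ_μ(π z) = φ(z) φ(z + e_μ)` with `φ = liftSign` (`liftSign_add_e1/2`).  Consequently the torus walk sum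
of length `j` between the projections of planar points `z, w` with `|z − w|₁ + j < L` (no walk of that length wraps) is the
planar walk sum `CellKappa.planarWalk` — the very object tabulated by the B6 certificate — up to the sign
`φ(z) φ(w)` (registered: `cellWalkPlanar`).  Corollary: the free propagator block between such points is
`φ(z)φ(w) · propTrunc J (z − w)` up to the Neumann tail `(2/M)^{J+1} (1 − 2/M)⁻¹/M` (`freeBlock_toTorus_approx`).
-/

noncomputable section

open scoped BigOperators Matrix Kronecker ComplexConjugate Matrix.Norms.L2Operator
open Matrix Literature.MathematicalPhysics.QuantumLattice
open Summit.QuantumFields.QCD.Cruxes.CriticalLineDiamagnetism.ChessboardCellGain.CellKappa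

namespace Summit.QuantumFields.QCD.Cruxes.CriticalLineDiamagnetism.ChessboardCellGain.CellWalk

variable {L : ℕ}

/-! ### The projection and the lift sign -/

/-- `toTorus` is additive. -/
theorem toTorus_add (z w : ℤ × ℤ) : toTorus L (z + w) = toTorus L z + toTorus L w := by
  simp [toTorus]

/-- `toTorus` respects subtraction. -/
theorem toTorus_sub (z w : ℤ × ℤ) : toTorus L (z - w) = toTorus L z - toTorus L w := by
  simp [toTorus]

/-- `toTorus e₁ = e₁`. -/
theorem toTorus_e1 : toTorus L (1, 0) = (1, 0) := by simp [toTorus]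

/-- `toTorus e₂ = e₂`. -/
theorem toTorus_e2 : toTorus L (0, 1) = (0, 1) := by simp [toTorus]

/-- The lift sign squares to one. -/
theorem liftSign_mul_self (z : ℤ × ℤ) : liftSign L z * liftSign L z = 1 := by
  rw [liftSign, ← zpow_add₀ (by norm_num : (-1 : ℂ) ≠ 0), ← two_mul]
  exact Even.neg_one_zpow (even_two_mul _)

/-- The lift sign has norm one. -/
theorem norm_liftSign (z : ℤ × ℤ) : ‖liftSign L z‖ = 1 := by
  rw [liftSign, norm_zpow, norm_neg, norm_one, _root_.one_zpow]

/-- Integer division of a successor: `(a + 1) / K = a / K + [K ∣ a + 1]` for `K > 0`. -/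
theorem int_add_one_ediv {K : ℤ} (hK : 0 < K) (a : ℤ) : (a + 1) / K = a / K + if K ∣ a + 1 then 1 else 0 := by
  by_cases h : K ∣ a + 1
  · obtain ⟨c, hc⟩ := h
    rw [if_pos ⟨c, hc⟩, hc, Int.mul_ediv_cancel_left _ hK.ne']
    have : a = (K - 1) + (c - 1) * K := by linarith
    rw [this, Int.add_mul_ediv_right _ _ hK.ne', Int.ediv_eq_zero_of_lt (by linarith) (by linarith)]
    ring
  · rw [if_neg h, add_zero]
    have h1 : a % K + K * (a / K) = a := Int.emod_add_mul_ediv a K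
    have h2 := Int.emod_nonneg a hK.ne'
    have h3 := Int.emod_lt_of_pos a hK
    have h4 : a % K + 1 < K := by
      rcases lt_or_eq_of_le (show a % K + 1 ≤ K by omega) with h5 | h5
      · exact h5
      · exact absurd ⟨a / K + 1, by linarith⟩ h
    conv_lhs => rw [← h1, show a % K + K * (a / K) + 1 = (a % K + 1) + (a / K) * K by ring]
    rw [Int.add_mul_ediv_right _ _ hK.ne', Int.ediv_eq_zero_of_lt (by linarith) h4, zero_add]

/-- The seam sign of an integer coordinate: `−1` iff `L ∣ a + 1`. -/
theorem seam_intCast_eq (a : ℤ) : seam ((a : ZMod L)) = if (L : ℤ) ∣ a + 1 then -1 else 1 := by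
  unfold seam
  have : ((a : ZMod L) = -1) ↔ (L : ℤ) ∣ a + 1 := by
    rw [← ZMod.intCast_zmod_eq_zero_iff_dvd, Int.cast_add, Int.cast_one, add_eq_zero_iff_eq_neg]
  by_cases h : (L : ℤ) ∣ a + 1
  · rw [if_pos (this.2 h), if_pos h]
  · rw [if_neg (fun h' => h (this.1 h')), if_neg h]

variable [NeZero L]

/-- **Pure gauge, first coordinate**: `φ(z + e₁) = σ₁(π z) φ(z)`. -/
theorem liftSign_add_e1 (z : ℤ × ℤ) : liftSign L (z + (1, 0)) = seam ((z.1 : ZMod L)) * liftSign L z := by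
  have hL : (0 : ℤ) < L := by exact_mod_cast Nat.pos_of_ne_zero (NeZero.ne L)
  rw [seam_intCast_eq, liftSign, liftSign, Prod.fst_add, Prod.snd_add, add_zero, int_add_one_ediv hL]
  split_ifs with h
  · rw [show z.1 / (L : ℤ) + 1 + z.2 / (L : ℤ) = (z.1 / (L : ℤ) + z.2 / (L : ℤ)) + 1 by ring,
      zpow_add_one₀ (by norm_num : (-1 : ℂ) ≠ 0)]
    ring
  · rw [add_zero, one_mul]

/-- **Pure gauge, second coordinate**: `φ(z + e₂) = σ₂(π z) φ(z)`. -/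
theorem liftSign_add_e2 (z : ℤ × ℤ) : liftSign L (z + (0, 1)) = seam ((z.2 : ZMod L)) * liftSign L z := by
  have hL : (0 : ℤ) < L := by exact_mod_cast Nat.pos_of_ne_zero (NeZero.ne L)
  rw [seam_intCast_eq, liftSign, liftSign, Prod.fst_add, Prod.snd_add, add_zero, int_add_one_ediv hL]
  split_ifs with h
  · rw [show z.1 / (L : ℤ) + (z.2 / (L : ℤ) + 1) = (z.1 / (L : ℤ) + z.2 / (L : ℤ)) + 1 by ring,
      zpow_add_one₀ (by norm_num : (-1 : ℂ) ≠ 0)]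
    ring
  · rw [add_zero, one_mul]

/-- Sign identity for the forward hop in the first coordinate. -/
theorem sign_fwd1 (z : ℤ × ℤ) : seam (toTorus L z).1 * liftSign L (z + (1, 0)) = liftSign L z := by
  rw [liftSign_add_e1, ← mul_assoc, show (toTorus L z).1 = (z.1 : ZMod L) from rfl, seam_mul_seam, one_mul]

/-- Sign identity for the backward hop in the first coordinate. -/
theorem sign_bwd1 (z : ℤ × ℤ) : seam (toTorus L (z - (1, 0))).1 * liftSign L (z - (1, 0)) = liftSign L z := by
  have h := sign_fwd1 (L := L) (z - (1, 0))
  rw [sub_add_cancel] at h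
  rw [← h, ← mul_assoc, seam_mul_seam, one_mul]

/-- Sign identity for the forward hop in the second coordinate. -/
theorem sign_fwd2 (z : ℤ × ℤ) : seam (toTorus L z).2 * liftSign L (z + (0, 1)) = liftSign L z := by
  rw [liftSign_add_e2, ← mul_assoc, show (toTorus L z).2 = (z.2 : ZMod L) from rfl, seam_mul_seam, one_mul]

/-- Sign identity for the backward hop in the second coordinate. -/
theorem sign_bwd2 (z : ℤ × ℤ) : seam (toTorus L (z - (0, 1))).2 * liftSign L (z - (0, 1)) = liftSign L z := by
  have h := sign_fwd2 (L := L) (z - (0, 1))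
  rw [sub_add_cancel] at h
  rw [← h, ← mul_assoc, seam_mul_seam, one_mul]

omit [NeZero L] in
/-- Distinct planar points at `ℓ¹`-distance `< L` have distinct projections. -/
theorem toTorus_ne_of_lt {z w : ℤ × ℤ} (hzw : |z.1 - w.1| + |z.2 - w.2| < L) (h : z ≠ w) : toTorus L z ≠ toTorus L w := by
  intro heq
  apply h
  simp only [toTorus, Prod.mk.injEq] at heq
  obtain ⟨h1, h2⟩ := heq
  have d1 : (L : ℤ) ∣ z.1 - w.1 := (ZMod.intCast_zmod_eq_zero_iff_dvd _ L).1 (by rw [Int.cast_sub, h1, sub_self])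
  have d2 : (L : ℤ) ∣ z.2 - w.2 := (ZMod.intCast_zmod_eq_zero_iff_dvd _ L).1 (by rw [Int.cast_sub, h2, sub_self])
  have e1 : z.1 - w.1 = 0 := Int.eq_zero_of_abs_lt_dvd d1 (by linarith [abs_nonneg (z.2 - w.2)])
  have e2 : z.2 - w.2 = 0 := Int.eq_zero_of_abs_lt_dvd d2 (by linarith [abs_nonneg (z.1 - w.1)])
  exact Prod.ext (by linarith) (by linarith)

/-! ### The identification -/

/-- **Planar identification below the girth.**  For planar points `z, w` with `|z − w|₁ + j < L`, the torus walk sum of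
length `j` between their projections is the planar walk sum up to the lift signs `φ(z) φ(w)` (induction on `j` along the
walk recursion; the seam signs are absorbed by the pure-gauge identities). -/
theorem torusWalk_toTorus (M s₀ s₁ : ℝ) : ∀ (j : ℕ) (z w : ℤ × ℤ), |z.1 - w.1| + |z.2 - w.2| + j < L →
    torusWalk L M s₀ s₁ j (toTorus L z) (toTorus L w) =
      (liftSign L z * liftSign L w) • planarWalk M s₀ s₁ j (z.1 - w.1, z.2 - w.2) := by
  intro j
  induction j with
  | zero =>
    intro z w hzw
    rw [torusWalk_zero, planarWalk]
    by_cases h : z = w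
    · subst h
      simp [liftSign_mul_self]
    · have hne := toTorus_ne_of_lt (L := L) (by simpa using hzw) h
      have hne' : (z.1 - w.1, z.2 - w.2) ≠ ((0 : ℤ), (0 : ℤ)) := by
        intro heq; apply h
        simp only [Prod.mk.injEq] at heq
        exact Prod.ext (by linarith [heq.1]) (by linarith [heq.2])
      rw [if_neg hne, if_neg hne', smul_zero]
  | succ j ih =>
    intro z w hzw
    push_cast at hzw
    have a1 : |z.1 + 1 - w.1| ≤ |z.1 - w.1| + 1 := by
      rw [show z.1 + 1 - w.1 = (z.1 - w.1) + 1 by ring]; exact (abs_add_le _ _).trans (by rw [abs_one])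
    have a2 : |z.1 - 1 - w.1| ≤ |z.1 - w.1| + 1 := by
      rw [show z.1 - 1 - w.1 = (z.1 - w.1) - 1 by ring]; exact (abs_sub _ _).trans (by rw [abs_one])
    have a3 : |z.2 + 1 - w.2| ≤ |z.2 - w.2| + 1 := by
      rw [show z.2 + 1 - w.2 = (z.2 - w.2) + 1 by ring]; exact (abs_add_le _ _).trans (by rw [abs_one])
    have a4 : |z.2 - 1 - w.2| ≤ |z.2 - w.2| + 1 := by
      rw [show z.2 - 1 - w.2 = (z.2 - w.2) - 1 by ring]; exact (abs_sub _ _).trans (by rw [abs_one])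
    have IH1 := ih (z + (1, 0)) w (by simp only [Prod.fst_add, Prod.snd_add, add_zero]; linarith)
    have IH2 := ih (z - (1, 0)) w (by simp only [Prod.fst_sub, Prod.snd_sub, sub_zero]; linarith)
    have IH3 := ih (z + (0, 1)) w (by simp only [Prod.fst_add, Prod.snd_add, add_zero]; linarith)
    have IH4 := ih (z - (0, 1)) w (by simp only [Prod.fst_sub, Prod.snd_sub, sub_zero]; linarith)
    rw [torusWalk_succ, ← toTorus_e1 (L := L), ← toTorus_e2 (L := L), ← toTorus_add, ← toTorus_sub, ← toTorus_add,
      ← toTorus_sub, IH1, IH2, IH3, IH4]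
    simp only [Matrix.mul_smul, smul_smul, ← mul_assoc]
    rw [sign_fwd1, sign_bwd1, sign_fwd2, sign_bwd2, ← smul_add, ← smul_add, ← smul_add, Matrix.mul_smul]
    congr 1
    rw [planarWalk]
    simp only [steps, List.map, List.sum_cons, List.sum_nil, add_zero, Prod.fst_add, Prod.snd_add, Prod.fst_sub,
      Prod.snd_sub, sub_zero]
    have e1 : z.1 + 1 - w.1 = z.1 - w.1 + 1 := by ring
    have e2 : z.1 - 1 - w.1 = z.1 - w.1 + -1 := by ring
    have e3 : z.2 + 1 - w.2 = z.2 - w.2 + 1 := by ring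
    have e4 : z.2 - 1 - w.2 = z.2 - w.2 + -1 := by ring
    rw [e1, e2, e3, e4]
    simp only [add_assoc]

/-- `propTrunc` as a `Finset` sum. -/
theorem propTrunc_eq_sum (M s₀ s₁ : ℝ) (J : ℕ) (z : ℤ × ℤ) :
    propTrunc M s₀ s₁ J z = ∑ j ∈ Finset.range (J + 1), planarWalk M s₀ s₁ j z := by
  unfold propTrunc
  have : ∀ N : ℕ, ((List.range N).map fun j => planarWalk M s₀ s₁ j z).sum =
      ∑ j ∈ Finset.range N, planarWalk M s₀ s₁ j z := by
    intro N
    induction N with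
    | zero => simp
    | succ N ih => rw [List.range_succ, List.map_append, List.sum_append, ih, Finset.sum_range_succ]; simp
  exact this (J + 1)

/-- **Planar approximation of the free propagator blocks below the girth**: for planar points `u, v` with
`|u − v|₁ + J < L`, `‖G(π u, π v) − φ(u)φ(v)·g_J(u − v)‖ ≤ (2/M)^{J+1} (1 − 2/M)⁻¹ / M`. -/
theorem freeBlock_toTorus_approx (M s₀ s₁ : ℝ) (hM : 2 < M) (J : ℕ) (u v w : ℤ × ℤ) (hw : (u.1 - v.1, u.2 - v.2) = w)
    (hL : |w.1| + |w.2| + J < L) :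
    ‖freeBlock L M s₀ s₁ (toTorus L u) (toTorus L v) - (liftSign L u * liftSign L v) • propTrunc M s₀ s₁ J w‖ ≤
      (2 / M) ^ (J + 1) * (1 - 2 / M)⁻¹ * (1 / M) := by
  have hM0 : 0 < M := by linarith
  have hxq := l2_opNorm_xHop_le (L := L) M s₀ s₁ hM0
  have hq : 2 / M < 1 := (div_lt_one hM0).2 hM
  subst hw
  have hsum : ∑ j ∈ Finset.range (J + 1), torusWalk L M s₀ s₁ j (toTorus L u) (toTorus L v) =
      (liftSign L u * liftSign L v) • propTrunc M s₀ s₁ J (u.1 - v.1, u.2 - v.2) := by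
    rw [propTrunc_eq_sum, Finset.smul_sum]
    refine Finset.sum_congr rfl fun j hj => torusWalk_toTorus M s₀ s₁ j u v ?_
    have := Finset.mem_range.1 hj
    simp only at hL
    linarith [show (j : ℤ) ≤ J by exact_mod_cast Nat.lt_succ_iff.mp this]
  rw [← hsum]
  exact norm_freeBlock_sub_le M s₀ s₁ hM0 hxq hq (J + 1) _ _

/-! ### Registered summary -/

/-- **Aux theorem `cellWalkPlanar`** (registered helper of `cellSecondOrder`): the planar identification of the torus walk
sums below the girth. -/
theorem cellWalkPlanar : ∀ (L : ℕ) [NeZero L] (M s₀ s₁ : ℝ) (j : ℕ) (z w : ℤ × ℤ), |z.1 - w.1| + |z.2 - w.2| + j < L → torusWalk L M s₀ s₁ j (toTorus L z) (toTorus L w) = (liftSign L z * liftSign L w) • CellKappa.planarWalk M s₀ s₁ j (z.1 - w.1, z.2 - w.2) :=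
  fun _ _ M s₀ s₁ j z w h => torusWalk_toTorus M s₀ s₁ j z w h

end Summit.QuantumFields.QCD.Cruxes.CriticalLineDiamagnetism.ChessboardCellGain.CellWalk

end
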